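import Summits.CriticalPhenomena.CardyFormulaZ2.Theorems.CardyComplexConeParafermionToSLESixFamiliesDiamondTouchLowerBox
import Summits.CriticalPhenomena.CardyFormulaZ2.Theorems.CardyComplexConeParafermionToSLESixFamiliesDiamondTouchLowerSite
import HarnessLib

/-!
# The touch probability of a touch-row site of a diamond discretisation dominates the glued events
# (line `potential-darboux-picard-diamond`, S3 (c) `freeTouchLower_of_diagArmLower`, part 7)

Crux `ParafermionToSLESixFamilies` (stmt-CriticalPhenomena-11389), line `potential-darboux-picard-diamond`, conditional
helper `freeTouchLower_of_diagArmLower` of S3. For an admissible datum on a marked diamond read at a small mesh (the box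
facts of `…TouchLowerBox`), a touch-row site `x` of side `k` (`dp[n, k, x] = 0`) and a connector on side `k'` whose
boundary layer consists of wired-arc sites: on the intersection of the arm, U, vertical-connector, ring and connector
events the site `x` is joined to the wired arc by an open path of the completed configuration (`site_conn` +
`touchEvent_of_openConnIn`), so `touchProb E x` dominates the probability of that intersection (`touchProb_ge_events`),
hence `c · P(armEv x 2m) · P(ringEv ∩ connEv) ≤ touchProb E x` (`touchProb_ge_glue`, Harris–FKG via `real_site_glue_ge`).
-/

noncomputable section

namespace Summit.CriticalPhenomena.CardyFormulaZ2.Cruxes.ParafermionToSLESixFamilies.PotentialDarbouxPicardDiamond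

open scoped Topology
open Filter Set Metric Complex MeasureTheory
open Literature.Probability Literature.Probability.LatticeModels Literature.Probability.Percolation
open Literature.Probability.LatticeModels.DiscreteDobrushin
open Literature.Probability.RandomPlanarGeometry
open Summit.CriticalPhenomena.CardyFormulaZ2.Cruxes.ParafermionToSLESixFamilies.IicTraceFluxPairing

/-- The depth of `v` below the touch row of side `k` (last inside layer `n k`). -/
local notation3 "dp[" n ", " k ", " v "]" => (n : Fin 4 → ℤ) k - 2 - layerFn (k + 2) v

/-- The rotation of side `k`. -/
local notation3 "SR[" k "]" => (![zdSignedPermIso (Equiv.swap 0 1) ![-1, 1], zdSignedPermIso 1 (fun _ => -1),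
    zdSignedPermIso (Equiv.swap 0 1) ![1, -1], zdSignedPermIso 1 (fun _ => 1)] : Fin 4 → (zdGraph 2 ≃g zdGraph 2)) k

/-- The lattice automorphism based at the site `x` of side `k`. -/
local notation3 "SI[" k ", " x "]" => (zdShiftIso ((SR[k]).symm x)).trans SR[k]

/-- The angle of the drawing of side `k`. -/
local notation3 "SA[" k "]" => (![-(Real.pi / 2), Real.pi, Real.pi / 2, 0] : Fin 4 → ℝ) k

/-- The isoradial drawing of side `k`. -/
local notation3 "SE[" n ", " k "]" => (gmEmbedding (fun _ => SA[k]) (fun _ => SA[k] + Real.pi / 2)).translate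
    ((((n : Fin 4 → ℤ) k - 2 : ℤ) : ℂ) * I)

/-- The interior of the lattice box: depth `≥ 0` below all four touch rows. -/
local notation3 "boxI[" n "]" => {v : Site 2 | ∀ j : Fin 4, 0 ≤ dp[n, j, v]}

/-- The strip of depth `≤ w` along side `j`, inside the interior. -/
local notation3 "strip[" n ", " w ", " j "]" => {v : Site 2 | (∀ i : Fin 4, 0 ≤ dp[n, i, v]) ∧ dp[n, j, v] ≤ w}

/-- The touch row of side `j` (depth `0`). -/
local notation3 "face[" n ", " j "]" => {v : Site 2 | dp[n, j, v] = 0}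

/-- The crossing event of the strip of side `j` (the long way, from the touch row of side `j + 3` to that of `j + 1`). -/
local notation3 "crossEv[" n ", " w ", " j "]" => openCrossing strip[n, w, j] face[n, j + 3] face[n, j + 1]

/-- The ring event: all four strips are crossed the long way. -/
local notation3 "ringEv[" n ", " w "]" => ⋂ j : Fin 4, crossEv[n, w, j]

/-- The connector of side `k` at tangential position `lo`: the box `[lo, lo + w] × [−1, w]` of the frame of side `k`. -/
local notation3 "connQ[" n ", " w ", " k ", " lo "]" => {v : Site 2 | lo ≤ layerFn (k + 3) v ∧ layerFn (k + 3) v ≤ lo + w ∧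
    -1 ≤ dp[n, k, v] ∧ dp[n, k, v] ≤ w}

/-- The connector event: the connector is crossed from the boundary layer `dp = −1` to the depth `w`. -/
local notation3 "connEv[" n ", " w ", " k ", " lo "]" => openCrossing connQ[n, w, k, lo] {v : Site 2 | dp[n, k, v] = -1}
    {v : Site 2 | dp[n, k, v] = w}

/-- The arm event of the touch-row site `x` of side `k` to half-plane distance `N`. -/
local notation3 "armEv[" n ", " k ", " x ", " N "]" => openCrossing
    {v : Site 2 | 0 ≤ dp[n, k, v] ∧ max |layerFn (k + 3) v - layerFn (k + 3) x| (dp[n, k, v] - dp[n, k, x]) ≤ N} {x}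
    {v : Site 2 | max |layerFn (k + 3) v - layerFn (k + 3) x| (dp[n, k, v] - dp[n, k, x]) = N}

/-- The U event at scale `m` around the site `x` of side `k` (two pillars crossed across, one bar crossed along). -/
local notation3 "uEv[" n ", " k ", " x ", " m "]" =>
    openCrossing {v : Site 2 | layerFn (k + 3) x + m ≤ layerFn (k + 3) v ∧ layerFn (k + 3) v ≤ layerFn (k + 3) x + 2 * m ∧
        0 ≤ dp[n, k, v] ∧ dp[n, k, v] ≤ dp[n, k, x] + 2 * m} {v : Site 2 | dp[n, k, v] = 0}
        {v : Site 2 | dp[n, k, v] = dp[n, k, x] + 2 * m} ∩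
      openCrossing {v : Site 2 | layerFn (k + 3) x - 2 * m ≤ layerFn (k + 3) v ∧ layerFn (k + 3) v ≤ layerFn (k + 3) x + 2 * m ∧
        dp[n, k, x] + m ≤ dp[n, k, v] ∧ dp[n, k, v] ≤ dp[n, k, x] + 2 * m} {v : Site 2 | layerFn (k + 3) v = layerFn (k + 3) x - 2 * m}
        {v : Site 2 | layerFn (k + 3) v = layerFn (k + 3) x + 2 * m} ∩
      openCrossing {v : Site 2 | layerFn (k + 3) x - 2 * m ≤ layerFn (k + 3) v ∧ layerFn (k + 3) v ≤ layerFn (k + 3) x - m ∧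
        0 ≤ dp[n, k, v] ∧ dp[n, k, v] ≤ dp[n, k, x] + 2 * m} {v : Site 2 | dp[n, k, v] = 0}
        {v : Site 2 | dp[n, k, v] = dp[n, k, x] + 2 * m}

/-- The vertical connector event at `x`: the box `[tng x − m, tng x + m] × [0, 3m]` of side `k` is crossed across. -/
local notation3 "vEv[" n ", " k ", " x ", " m "]" => openCrossing
    {v : Site 2 | layerFn (k + 3) x - m ≤ layerFn (k + 3) v ∧ layerFn (k + 3) v ≤ layerFn (k + 3) x + m ∧ 0 ≤ dp[n, k, v] ∧
      dp[n, k, v] ≤ 3 * m} {v : Site 2 | dp[n, k, v] = 0} {v : Site 2 | dp[n, k, v] = 3 * m}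

/-- **The connector lies in the box**: every site of `connQ[n, w, k', lo]` (with the connector inside the tangential range
and `w` at most the depth) has `layerFn (j+2) ≤ n j` on every side; it is in the interior unless it is on the boundary
layer `dp = −1`. -/
theorem connQ_layers (n : Fin 4 → ℤ) {w : ℤ} (hw : ∀ j, w ≤ n j + n (j + 2) - 4) (k' : Fin 4) {lo : ℤ}
    (hlo : 2 - n (k' + 3) ≤ lo) (hlo' : lo + w ≤ n (k' + 1) - 2) {v : Site 2} (hv : v ∈ connQ[n, w, k', lo]) :
    (∀ j, layerFn (j + 2) v ≤ n j) ∧ (0 ≤ dp[n, k', v] → v ∈ boxI[n]) := by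
  obtain ⟨h1, h2, h3, h4⟩ := hv
  have hT := hw k'
  have key : ∀ j, -1 ≤ dp[n, j, v] := by
    intro j
    obtain ⟨i, rfl⟩ := exists_eq_add k' j
    fin_cases i
    · simpa using h3
    · show -1 ≤ dp[n, k' + 1, v]
      rw [dp_succ]; omega
    · show -1 ≤ dp[n, k' + 2, v]
      rw [dp_add_two]; omega
    · show -1 ≤ dp[n, k' + 3, v]
      rw [dp_add_three]; omega
  refine ⟨fun j => by have := key j; omega, fun h0 => ?_⟩
  exact (forall_dp_nonneg_iff n k' v).2 ⟨by omega, by omega, h0, by omega⟩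

section Site

variable {D : DobrushinDomain} {c : ℂ} {α β : ℝ}
  (hcar : D.carrier = {z : ℂ | |((z - c) * exp (-(Real.pi / 4 : ℝ) * I)).re| < α ∧ |((z - c) * exp (-(Real.pi / 4 : ℝ) * I)).im| < β})
  {δ : ℝ} (hδ : 0 < δ) {E : DiscreteDobrushin} (hΩ : E.Ω = D.carrier) (hEδ : E.δ = δ)
  (hgood : ∀ x : Site 2, meshPoint δ x ∈ D.carrier → x ∈ meshDomain D.carrier δ) {X₀ Y₀ : Fin 4 → ℝ} {n : Fin 4 → ℤ}
  (hch : ∀ k : Fin 4,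
    ‖exp (-(Real.pi / 4 : ℝ) * I) * sideFrame k‖ = 1 ∧
    {z : ℂ | |((z - c) * exp (-(Real.pi / 4 : ℝ) * I)).re| < α ∧ |((z - c) * exp (-(Real.pi / 4 : ℝ) * I)).im| < β} =
      {z : ℂ | |((z - c) * (exp (-(Real.pi / 4 : ℝ) * I) * sideFrame k)).re| < sideHalfWidth α β k ∧
        |((z - c) * (exp (-(Real.pi / 4 : ℝ) * I) * sideFrame k)).im| < sideHalfLength α β k} ∧
    (∀ x : Site 2, ((meshPoint δ x - c) * (exp (-(Real.pi / 4 : ℝ) * I) * sideFrame k)).re =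
      Real.sqrt 2 / 2 * δ * layerFn (k + 2) x + X₀ k) ∧
    (∀ x : Site 2, ((meshPoint δ x - c) * (exp (-(Real.pi / 4 : ℝ) * I) * sideFrame k)).im =
      Real.sqrt 2 / 2 * δ * layerFn (k + 2 + 1) x + Y₀ k) ∧
    Real.sqrt 2 / 2 * δ * n k + X₀ k < sideHalfWidth α β k ∧ sideHalfWidth α β k ≤ Real.sqrt 2 / 2 * δ * (n k + 1) + X₀ k)
  (h6 : 6 ≤ n 1 + n 3)

include hcar hδ hΩ hEδ hgood hch h6 in
/-- Interior sites are off both arcs. -/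
theorem not_mem_arcs_of_boxI {v : Site 2} (hv : v ∈ boxI[n]) : v ∉ E.zdBoundary ∧ v ∉ E.zdArcA ∧ v ∉ E.zdArcB :=
  not_mem_arcs_of_interior hcar hδ hΩ hEδ hgood hch h6 fun j => by have := hv j; omega

include hcar hδ hΩ hEδ hgood hch h6 in
/-- **The glued events imply the touch event.** For a touch-row site `x` of side `k` and a connector on side `k'` whose
boundary layer is made of sites off `B` (and on `A` when on the discrete boundary): on the arm, U, vertical-connector,
ring and connector events (and for a lattice configuration), `x ↔ A` in the completed configuration. -/
theorem touchEvent_of_events (k k' : Fin 4) {x : Site 2} (hx : dp[n, k, x] = 0) {m w lo : ℤ}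
    (hw : ∀ j, w ≤ n j + n (j + 2) - 4) (hw1 : 1 ≤ w) (hm : 1 ≤ m) (hw3 : w ≤ 3 * m) (h3m : 3 * m ≤ n k + n (k + 2) - 4)
    (hL₁ : 2 - n (k + 3) ≤ layerFn (k + 3) x - 2 * m) (hL₂ : layerFn (k + 3) x + 2 * m ≤ n (k + 1) - 2)
    (hlo : 2 - n (k' + 3) ≤ lo) (hlo' : lo + w ≤ n (k' + 1) - 2)
    (hQA : ∀ v : Site 2, dp[n, k', v] = -1 → lo ≤ layerFn (k' + 3) v → layerFn (k' + 3) v ≤ lo + w →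
      v ∉ E.zdArcB ∧ (v ∈ E.zdBoundary → v ∈ E.zdArcA))
    {ω : BondConfig (Site 2)} (hω : ω ⊆ (zdGraph 2).edgeSet)
    (hev : ω ∈ armEv[n, k, x, 2 * m] ∩ uEv[n, k, x, m] ∩ vEv[n, k, x, m] ∩ (ringEv[n, w] ∩ connEv[n, w, k', lo])) :
    ∃ y ∈ E.zdArcA, (openGraph (E.bcBondConfig ω)).Reachable x y := by
  obtain ⟨⟨⟨hA, hU⟩, hV⟩, hR, hQ⟩ := hev
  obtain ⟨y, hy, hy1, hy2, hconn⟩ := site_conn n hw hw1 k k' hx hm hw3 h3m hL₁ hL₂ hlo hlo' hω hA hU hV hR hQ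
  have hyQ : y ∈ connQ[n, w, k', lo] := ⟨hy1, hy2, by omega, by omega⟩
  obtain ⟨hyB, hyA⟩ := hQA y hy hy1 hy2
  have hybd : y ∈ E.zdBoundary := by
    rw [mem_zdBoundary_iff_exists hcar hδ hΩ hEδ hgood hch h6]
    exact ⟨(connQ_layers n hw k' hlo hlo' hyQ).1, k', by omega⟩
  refine touchEvent_of_openConnIn hcar hδ hΩ hEδ hgood hch hω (R := boxI[n] ∪ connQ[n, w, k', lo]) ?_ ?_ (hyA hybd) hconn
  · rintro v (hv | hv) j
    · have := hv j; omega
    · exact (connQ_layers n hw k' hlo hlo' hv).1 j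
  · rintro v (hv | hv)
    · exact (not_mem_arcs_of_boxI hcar hδ hΩ hEδ hgood hch h6 hv).2.2
    · rcases lt_or_ge dp[n, k', v] 0 with hlt | hge
      · have : dp[n, k', v] = -1 := by have := hv.2.2.1; omega
        exact (hQA v this hv.1 hv.2.1).1
      · exact (not_mem_arcs_of_boxI hcar hδ hΩ hEδ hgood hch h6 ((connQ_layers n hw k' hlo hlo' hv).2 hge)).2.2

include hcar hδ hΩ hEδ hgood hch h6 in
/-- **The touch probability dominates the glued events.** -/
theorem touchProb_ge_events (k k' : Fin 4) {x : Site 2} (hx : dp[n, k, x] = 0) {m w lo : ℤ}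
    (hw : ∀ j, w ≤ n j + n (j + 2) - 4) (hw1 : 1 ≤ w) (hm : 1 ≤ m) (hw3 : w ≤ 3 * m) (h3m : 3 * m ≤ n k + n (k + 2) - 4)
    (hL₁ : 2 - n (k + 3) ≤ layerFn (k + 3) x - 2 * m) (hL₂ : layerFn (k + 3) x + 2 * m ≤ n (k + 1) - 2)
    (hlo : 2 - n (k' + 3) ≤ lo) (hlo' : lo + w ≤ n (k' + 1) - 2)
    (hQA : ∀ v : Site 2, dp[n, k', v] = -1 → lo ≤ layerFn (k' + 3) v → layerFn (k' + 3) v ≤ lo + w →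
      v ∉ E.zdArcB ∧ (v ∈ E.zdBoundary → v ∈ E.zdArcA)) :
    (bondPercolation (zdGraph 2) half).real
        (armEv[n, k, x, 2 * m] ∩ uEv[n, k, x, m] ∩ vEv[n, k, x, m] ∩ (ringEv[n, w] ∩ connEv[n, w, k', lo])) ≤
      touchProb E x := by
  unfold touchProb
  refine ENNReal.toReal_mono (measure_ne_top _ _) (measure_mono_ae ?_)
  filter_upwards [ae_subset_edgeSet (zdGraph 2) half] with ω hω hev
  exact touchEvent_of_events hcar hδ hΩ hEδ hgood hch h6 k k' hx hw hw1 hm hw3 h3m hL₁ hL₂ hlo hlo' hQA hω hev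

end Site

/-- **The gluing bound for the touch probability.** There are `c > 0` and `m₀` (independent of everything else) such
that for every admissible datum on a marked diamond with its box facts, touch-row site `x` of side `k`, scale `m ≥ m₀`,
strip width `w` and connector on side `k'` as in `touchProb_ge_events`:
`c · P(armEv[n, k, x, 2m]) · P(ringEv[n, w] ∩ connEv[n, w, k', lo]) ≤ touchProb E x`. -/
theorem touchProb_ge_glue : ∃ c₀ : ℝ, 0 < c₀ ∧ ∃ m₀ : ℕ, ∀ (D : DobrushinDomain) (c : ℂ) (α β : ℝ),
    D.carrier = {z : ℂ | |((z - c) * exp (-(Real.pi / 4 : ℝ) * I)).re| < α ∧ |((z - c) * exp (-(Real.pi / 4 : ℝ) * I)).im| < β} →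
    ∀ (δ : ℝ), 0 < δ → ∀ (E : DiscreteDobrushin), E.Ω = D.carrier → E.δ = δ →
    (∀ x : Site 2, meshPoint δ x ∈ D.carrier → x ∈ meshDomain D.carrier δ) → ∀ (X₀ Y₀ : Fin 4 → ℝ) (n : Fin 4 → ℤ),
    (∀ k : Fin 4,
      ‖exp (-(Real.pi / 4 : ℝ) * I) * sideFrame k‖ = 1 ∧
      {z : ℂ | |((z - c) * exp (-(Real.pi / 4 : ℝ) * I)).re| < α ∧ |((z - c) * exp (-(Real.pi / 4 : ℝ) * I)).im| < β} =
        {z : ℂ | |((z - c) * (exp (-(Real.pi / 4 : ℝ) * I) * sideFrame k)).re| < sideHalfWidth α β k ∧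
          |((z - c) * (exp (-(Real.pi / 4 : ℝ) * I) * sideFrame k)).im| < sideHalfLength α β k} ∧
      (∀ x : Site 2, ((meshPoint δ x - c) * (exp (-(Real.pi / 4 : ℝ) * I) * sideFrame k)).re =
        Real.sqrt 2 / 2 * δ * layerFn (k + 2) x + X₀ k) ∧
      (∀ x : Site 2, ((meshPoint δ x - c) * (exp (-(Real.pi / 4 : ℝ) * I) * sideFrame k)).im =
        Real.sqrt 2 / 2 * δ * layerFn (k + 2 + 1) x + Y₀ k) ∧
      Real.sqrt 2 / 2 * δ * n k + X₀ k < sideHalfWidth α β k ∧ sideHalfWidth α β k ≤ Real.sqrt 2 / 2 * δ * (n k + 1) + X₀ k) →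
    6 ≤ n 1 + n 3 → ∀ (k k' : Fin 4) (x : Site 2), dp[n, k, x] = 0 → ∀ (m w lo : ℤ), (m₀ : ℤ) ≤ m →
    (∀ j, w ≤ n j + n (j + 2) - 4) → 1 ≤ w → w ≤ 3 * m → 3 * m ≤ n k + n (k + 2) - 4 →
    2 - n (k + 3) ≤ layerFn (k + 3) x - 2 * m → layerFn (k + 3) x + 2 * m ≤ n (k + 1) - 2 →
    2 - n (k' + 3) ≤ lo → lo + w ≤ n (k' + 1) - 2 →
    (∀ v : Site 2, dp[n, k', v] = -1 → lo ≤ layerFn (k' + 3) v → layerFn (k' + 3) v ≤ lo + w →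
      v ∉ E.zdArcB ∧ (v ∈ E.zdBoundary → v ∈ E.zdArcA)) →
    c₀ * (bondPercolation (zdGraph 2) half).real armEv[n, k, x, 2 * m] *
        (bondPercolation (zdGraph 2) half).real (ringEv[n, w] ∩ connEv[n, w, k', lo]) ≤ touchProb E x := by
  obtain ⟨c₀, hc₀, m₀, h⟩ := real_site_glue_ge
  refine ⟨c₀, hc₀, m₀ + 1, ?_⟩
  intro D c α β hcar δ hδ E hΩ hEδ hgood X₀ Y₀ n hch h6 k k' x hx m w lo hm hw hw1 hw3 h3m hL₁ hL₂ hlo hlo' hQA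
  have key := h n k x hx m (by push_cast at hm; omega) (ringEv[n, w] ∩ connEv[n, w, k', lo])
    ((isUpperSet_ringEv n w).inter (isUpperSet_openCrossing _ _ _))
    ((measurableSet_ringEv n w).inter (measurableSet_connEv n w k' lo))
  exact key.trans (touchProb_ge_events hcar hδ hΩ hEδ hgood hch h6 k k' hx hw hw1 (by push_cast at hm; omega) hw3 h3m hL₁
    hL₂ hlo hlo' hQA)

/-- **Registered form of `connQ_layers` (helper of `freeTouchLower_of_diagArmLower`), notation-free: the connector lies in
the lattice box.** -/
theorem touchLower_connQ_layers : ∀ (n : Fin 4 → ℤ) (w : ℤ), (∀ j : Fin 4, w ≤ n j + n (j + 2) - 4) → ∀ (k' : Fin 4) (lo : ℤ), 2 - n (k' + 3) ≤ lo → lo + w ≤ n (k' + 1) - 2 → ∀ v : Site 2, lo ≤ layerFn (k' + 3) v → layerFn (k' + 3) v ≤ lo + w → -1 ≤ n k' - 2 - layerFn (k' + 2) v → n k' - 2 - layerFn (k' + 2) v ≤ w → ∀ j : Fin 4, layerFn (j + 2) v ≤ n j :=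
  fun n _ hw k' _ hlo hlo' _ h1 h2 h3 h4 => (connQ_layers n hw k' hlo hlo' ⟨h1, h2, h3, h4⟩).1

end Summit.CriticalPhenomena.CardyFormulaZ2.Cruxes.ParafermionToSLESixFamilies.PotentialDarbouxPicardDiamond

end
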